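import Mathlib
import HarnessLib
import Summits.Ventures.LatticeQCDFlow.Scaling.IdentityFlowCouplingStrict
import Summits.Ventures.LatticeQCDFlow.Scaling.IdentityFlowWeakCouplingLimit
import Summits.Ventures.LatticeQCDFlow.Scaling.WilsonZeroActionSet

/-!
# LatticeQCDFlow / Scaling — the WEAK-COUPLING LIMIT of the untrained Wilson sampler: as `β → ∞`
# its acceptance ceiling `Z(β/2)²/Z(β)` and its ESS `Z(β)²/Z(2β)` BOTH converge to the Haar measure
# of the zero-action configurations; if that set is Haar-null the acceptance tends to `0`

HONEST FRAMING: exact (Metropolis-corrected) sampling algorithms for lattice gauge theory;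
figures of merit are autocorrelation/cost numbers at stated couplings and volumes; no
continuum-physics claim.

Venture `LatticeQCDFlow` (cell pub-lqcd), topic `Scaling`; FANOUT row 3 (`s0-u1-a`, S0-B
implementation A, GEN-16).  NEW WORK of the cell (elementary), not a published result; NO definition
is introduced.  The Wilson instance of row 3's `Scaling/IdentityFlowWeakCouplingLimit` (GEN-16,
imported: for a tilt family `e^{βT}μ/Z(β)` with `T ≤ M` an essential maximum,
`Z(β/2)²/Z(β) → μ{T = M}` and `Z(β)²/Z(2β) → μ{T = M}` as `β → ∞`).  Setting = theory-2's Wilson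
lattice gauge theory (compact `G`, continuous matrix representation `ρ`, torus `(ℤ/L)^d`, action
`S = Σ_p (N − Re tr ρ(U_p)) ≥ 0` since `Re tr ρ ≤ N` by the unitary trick), reference law product
Haar, `T = −S`, `M = 0` (the small-ball function `Haar{S ≤ ε} > 0` of
`Literature…WilsonEnergyConvexity` makes `0` the essential maximum), `Z = (partitionFunction ρ ·).toReal`:

* `neg_wilsonAction_sharp` (book-keeping, with `Re tr ρ ≤ N` from the Literature's `CompactGroup.abs_re_trace_le_card` inlined; `partitionFunction_toReal_eq_mgf` is row 3's
  `Scaling/IdentityFlowCouplingStrict`, imported);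
* **`wilsonIdentityFlow_bhattSq_tendsto`** — `Z(β/2)²/Z(β) → Haar^{⊗E}{U | S(U) = 0}`;
* **`wilsonIdentityFlow_essFrac_tendsto`** — `Z(β)²/Z(2β) → Haar^{⊗E}{U | S(U) = 0}` (the exact ESS of
  `Scaling/WilsonIdentityFlowLaw`, same limit);
* **`wilsonIdentityFlow_meanAccept_weakCoupling_tendsto_zero`** — if the zero-action set is Haar-null, the
  equilibrium acceptance of the untrained sampler tends to `0` (squeezed under the ceiling of
  `wilsonIdentityFlow_meanAccept_mem_Icc_partitionFunction`);
* **U(1), unconditionally** (row 3's `Scaling/WilsonZeroActionSet`: the flat set of compact U(1) on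
  `(ℤ/L)^d`, `L ≥ 2`, directions `i < j`, is Haar-null): **`u1IdentityFlow_torus_bhattSq_tendsto_zero`**,
  **`u1IdentityFlow_torus_essFrac_tendsto_zero`**, **`u1IdentityFlow_torus_meanAccept_tendsto_zero`**;
  **SU(2)** likewise (`su2IdentityFlow_torus_bhattSq_tendsto_zero`, `…_essFrac_…`, `…_meanAccept_…`,
  from `measure_pi_su2_wilsonAction_eq_zero_null`); and the finite-group contrast `measureReal_pi_wilsonAction_eq_zero_ge_of_finite` (the limit is at
  least `|G|^{−#E}`).

Reading (value-free; no number of ours is computed or implied): at weak coupling the untrained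
exact sampler of a Wilson theory survives exactly to the extent that flat (zero-action)
configurations carry Haar mass — for a finite gauge group the limiting ceiling and ESS are positive
(`≥ |G|^{−E}`, the mass of the trivial configuration), while whenever the zero-action set is
Haar-null the acceptance, its ceiling and the ESS all vanish as `β → ∞`, for every `d`, `L`.
NOT CLAIMED: Haar-nullity of the zero-action set for continuous groups on the torus (true, not
typed here); the rate of decay; any value at the cell's `(β, L)`; nothing re-scored, SEALED.md
untouched.
-/

noncomputable section

namespace Summit.Ventures.LatticeQCDFlow.Theory2

open MeasureTheory Real Set Filter Topology ProbabilityTheory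
open Literature.MathematicalPhysics.QuantumLattice (u1Rep continuous_u1Rep fundamentalRep
  continuous_fundamentalRep)

/-! ## Wilson lattice gauge theory: the limit is the Haar measure of the zero-action set -/

section Wilson

open Literature.MathematicalPhysics.QuantumFieldTheory

variable {d L N : ℕ} [NeZero L] {G : Type*} [Group G] [TopologicalSpace G] [IsTopologicalGroup G]
  [CompactSpace G] [MeasurableSpace G] [BorelSpace G] (ρ : G →* Matrix (Fin N) (Fin N) ℂ)

/-- The hypotheses of §1 for `T = −S`, `M = 0` under product Haar: measurability, `−S ≤ 0`,
and `Haar{−ε < −S} > 0`. [ours] -/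
theorem neg_wilsonAction_sharp (hρ : Continuous ρ) :
    Measurable (fun U : GaugeConfig d L G => -wilsonAction ρ U) ∧
    (∀ U : GaugeConfig d L G, -wilsonAction ρ U ≤ 0) ∧
    (∀ ε : ℝ, 0 < ε → 0 < (Measure.pi fun _ : Edge d L => haarProbability G)
      {U : GaugeConfig d L G | 0 - ε < -wilsonAction ρ U}) := by
  refine ⟨(WilsonRP.measurable_wilsonAction ρ hρ).neg,
    fun U => neg_nonpos.2 (wilsonAction_nonneg_of_re_trace_le ρ (fun g => by
      -- `Re tr ρ(g) ≤ N` (the Literature's `CompactGroup.abs_re_trace_le_card`; an identical statement is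
      -- `…FemtoCurvatureTwoPoint.PlaquetteVariance.re_trace_le` in the YangMills summit, hence no restatement)
      have hb := Literature.RepresentationTheory.CompactGroups.CompactGroup.abs_re_trace_le_card ρ hρ g
      rw [Fintype.card_fin] at hb
      exact (le_abs_self _).trans hb) U),
    fun ε hε => ?_⟩
  have hpos := measureReal_wilsonAction_le_pos (d := d) (L := L) ρ hρ (half_pos hε)
  have hsub : {U : GaugeConfig d L G | wilsonAction ρ U ≤ ε / 2}
      ⊆ {U : GaugeConfig d L G | 0 - ε < -wilsonAction ρ U} := fun U hU => by
    have hU' : wilsonAction ρ U ≤ ε / 2 := hU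
    show 0 - ε < -wilsonAction ρ U
    linarith
  exact lt_of_lt_of_le ((ENNReal.toReal_pos_iff.1 hpos).1) (measure_mono hsub)

/-- **WEAK-COUPLING LIMIT OF THE ACCEPTANCE CEILING**: `Z(β/2)²/Z(β) → Haar^{⊗E}{S = 0}` as
`β → ∞`, for every compact `G`, continuous `ρ`, `d`, `L` (`Z = (partitionFunction ρ ·).toReal`).
[ours] -/
theorem wilsonIdentityFlow_bhattSq_tendsto (hρ : Continuous ρ) :
    Tendsto (fun β : ℝ => (partitionFunction (d := d) (L := L) ρ (β / 2)).toReal ^ 2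
        / (partitionFunction (d := d) (L := L) ρ β).toReal) atTop
      (𝓝 ((Measure.pi fun _ : Edge d L => haarProbability G).real
        {U : GaugeConfig d L G | wilsonAction ρ U = 0})) := by
  obtain ⟨hm, hle, hsharp⟩ := neg_wilsonAction_sharp (d := d) (L := L) ρ hρ
  have h := tendsto_mgf_half_sq_div hm hle hsharp
  simp_rw [partitionFunction_toReal_eq_mgf ρ hρ]
  have e : {U : GaugeConfig d L G | -wilsonAction ρ U = 0} = {U | wilsonAction ρ U = 0} := by
    ext U; simp
  rw [e] at h
  exact h

/-- **WEAK-COUPLING LIMIT OF THE ESS**: `Z(β)²/Z(2β) → Haar^{⊗E}{S = 0}` as `β → ∞`. [ours] -/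
theorem wilsonIdentityFlow_essFrac_tendsto (hρ : Continuous ρ) :
    Tendsto (fun β : ℝ => (partitionFunction (d := d) (L := L) ρ β).toReal ^ 2
        / (partitionFunction (d := d) (L := L) ρ (2 * β)).toReal) atTop
      (𝓝 ((Measure.pi fun _ : Edge d L => haarProbability G).real
        {U : GaugeConfig d L G | wilsonAction ρ U = 0})) := by
  obtain ⟨hm, hle, hsharp⟩ := neg_wilsonAction_sharp (d := d) (L := L) ρ hρ
  have h := tendsto_mgf_sq_div_double hm hle hsharp
  simp_rw [partitionFunction_toReal_eq_mgf ρ hρ]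
  have e : {U : GaugeConfig d L G | -wilsonAction ρ U = 0} = {U | wilsonAction ρ U = 0} := by
    ext U; simp
  rw [e] at h
  exact h

/-- **If the zero-action set is Haar-null, the untrained sampler's acceptance tends to `0`** as
`β → ∞` (squeezed under the Bhattacharyya ceiling of `Scaling/WilsonIdentityFlowLaw`). [ours] -/
theorem wilsonIdentityFlow_meanAccept_weakCoupling_tendsto_zero (hρ : Continuous ρ)
    (hnull : (Measure.pi fun _ : Edge d L => haarProbability G)
      {U : GaugeConfig d L G | wilsonAction ρ U = 0} = 0) :
    Tendsto (fun β : ℝ => ∫ U, ∫ U', min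
        (Real.exp (-β * wilsonAction ρ U) / ∫ V, Real.exp (-β * wilsonAction ρ V)
            ∂(Measure.pi fun _ : Edge d L => haarProbability G))
        (Real.exp (-β * wilsonAction ρ U') / ∫ V, Real.exp (-β * wilsonAction ρ V)
            ∂(Measure.pi fun _ : Edge d L => haarProbability G))
        ∂(Measure.pi fun _ : Edge d L => haarProbability G)
        ∂(Measure.pi fun _ : Edge d L => haarProbability G)) atTop (𝓝 0) := by
  have hceil := wilsonIdentityFlow_bhattSq_tendsto (d := d) (L := L) ρ hρ
  rw [measureReal_def, hnull, ENNReal.toReal_zero] at hceil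
  refine tendsto_of_tendsto_of_tendsto_of_le_of_le tendsto_const_nhds hceil (fun β => ?_) fun β => ?_
  · have h := (wilsonIdentityFlow_meanAccept_mem_Icc_partitionFunction (d := d) (L := L) ρ hρ β).1
    exact le_trans (mul_nonneg (by norm_num) (div_nonneg (sq_nonneg _) ENNReal.toReal_nonneg)) h
  · exact (wilsonIdentityFlow_meanAccept_mem_Icc_partitionFunction (d := d) (L := L) ρ hρ β).2


/-! ## U(1) on the torus, unconditionally; finite groups -/

/-- **U(1): the acceptance ceiling `Z(β/2)²/Z(β)` of the untrained sampler of compact U(1) lattice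
gauge theory on `(ℤ/L)^d` (`L ≥ 2`, directions `i < j`) tends to `0` as `β → ∞`.** [ours] -/
theorem u1IdentityFlow_torus_bhattSq_tendsto_zero [Fact (1 < L)] {i j : Fin d} (hij : i < j) :
    Tendsto (fun β : ℝ => (partitionFunction (d := d) (L := L) u1Rep (β / 2)).toReal ^ 2
        / (partitionFunction (d := d) (L := L) u1Rep β).toReal) atTop (𝓝 0) := by
  have h := wilsonIdentityFlow_bhattSq_tendsto (d := d) (L := L) u1Rep continuous_u1Rep
  rwa [measureReal_def, measure_pi_u1_wilsonAction_eq_zero_null hij, ENNReal.toReal_zero] at h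

/-- **U(1): the ESS `Z(β)²/Z(2β)` of the untrained sampler tends to `0` as `β → ∞`.** [ours] -/
theorem u1IdentityFlow_torus_essFrac_tendsto_zero [Fact (1 < L)] {i j : Fin d} (hij : i < j) :
    Tendsto (fun β : ℝ => (partitionFunction (d := d) (L := L) u1Rep β).toReal ^ 2
        / (partitionFunction (d := d) (L := L) u1Rep (2 * β)).toReal) atTop (𝓝 0) := by
  have h := wilsonIdentityFlow_essFrac_tendsto (d := d) (L := L) u1Rep continuous_u1Rep
  rwa [measureReal_def, measure_pi_u1_wilsonAction_eq_zero_null hij, ENNReal.toReal_zero] at h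

/-- **U(1): the equilibrium acceptance of the untrained sampler tends to `0` as `β → ∞`**
(`(ℤ/L)^d`, `L ≥ 2`, directions `i < j`). [ours] -/
theorem u1IdentityFlow_torus_meanAccept_tendsto_zero [Fact (1 < L)] {i j : Fin d} (hij : i < j) :
    Tendsto (fun β : ℝ => ∫ U, ∫ U', min
        (Real.exp (-β * wilsonAction u1Rep U) / ∫ V, Real.exp (-β * wilsonAction u1Rep V)
            ∂(Measure.pi fun _ : Edge d L => haarProbability Circle))
        (Real.exp (-β * wilsonAction u1Rep U') / ∫ V, Real.exp (-β * wilsonAction u1Rep V)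
            ∂(Measure.pi fun _ : Edge d L => haarProbability Circle))
        ∂(Measure.pi fun _ : Edge d L => haarProbability Circle)
        ∂(Measure.pi fun _ : Edge d L => haarProbability Circle)) atTop (𝓝 0) :=
  wilsonIdentityFlow_meanAccept_weakCoupling_tendsto_zero (d := d) (L := L) u1Rep continuous_u1Rep
    (measure_pi_u1_wilsonAction_eq_zero_null hij)

/-- **Finite gauge groups**: the weak-coupling limit `Haar^{⊗E}{S = 0}` of the acceptance ceiling and
of the ESS is at least `|G|^{−#E} > 0` — the untrained sampler of a finite gauge theory does not die
at weak coupling. [ours] -/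
theorem measureReal_pi_wilsonAction_eq_zero_ge_of_finite [Fintype G] [DiscreteTopology G] :
    ((Fintype.card G : ℝ)⁻¹) ^ Fintype.card (Edge d L)
      ≤ (Measure.pi fun _ : Edge d L => haarProbability G).real
        {U : GaugeConfig d L G | wilsonAction ρ U = 0} := by
  have h := measure_pi_wilsonAction_eq_zero_pos_of_finite (d := d) (L := L) ρ
  have hcard : (Fintype.card G : ENNReal) ≠ 0 := by exact_mod_cast Fintype.card_ne_zero
  rw [measureReal_def]
  refine le_trans (le_of_eq ?_) (ENNReal.toReal_mono (measure_ne_top _ _) h)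
  rw [ENNReal.toReal_pow, ENNReal.toReal_inv, ENNReal.toReal_natCast]

/-- **SU(2): the acceptance ceiling `Z(β/2)²/Z(β)` of the untrained sampler of SU(2) lattice gauge
theory on `(ℤ/L)^d` (`L ≥ 2`, directions `i < j`) tends to `0` as `β → ∞`** (the flat set is
Haar-null: `measure_pi_su2_wilsonAction_eq_zero_null`). [ours] -/
theorem su2IdentityFlow_torus_bhattSq_tendsto_zero [Fact (1 < L)] {i j : Fin d} (hij : i < j) :
    Tendsto (fun β : ℝ =>
      (partitionFunction (d := d) (L := L) (fundamentalRep (Fin 2)) (β / 2)).toReal ^ 2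
        / (partitionFunction (d := d) (L := L) (fundamentalRep (Fin 2)) β).toReal) atTop (𝓝 0) := by
  have h := wilsonIdentityFlow_bhattSq_tendsto (d := d) (L := L) (fundamentalRep (Fin 2))
    (continuous_fundamentalRep (Fin 2))
  rwa [measureReal_def, measure_pi_su2_wilsonAction_eq_zero_null hij, ENNReal.toReal_zero] at h

/-- **SU(2): the ESS `Z(β)²/Z(2β)` of the untrained sampler tends to `0` as `β → ∞`.** [ours] -/
theorem su2IdentityFlow_torus_essFrac_tendsto_zero [Fact (1 < L)] {i j : Fin d} (hij : i < j) :
    Tendsto (fun β : ℝ =>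
      (partitionFunction (d := d) (L := L) (fundamentalRep (Fin 2)) β).toReal ^ 2
        / (partitionFunction (d := d) (L := L) (fundamentalRep (Fin 2)) (2 * β)).toReal)
      atTop (𝓝 0) := by
  have h := wilsonIdentityFlow_essFrac_tendsto (d := d) (L := L) (fundamentalRep (Fin 2))
    (continuous_fundamentalRep (Fin 2))
  rwa [measureReal_def, measure_pi_su2_wilsonAction_eq_zero_null hij, ENNReal.toReal_zero] at h

/-- **SU(2): the equilibrium acceptance of the untrained sampler tends to `0` as `β → ∞`.** [ours] -/
theorem su2IdentityFlow_torus_meanAccept_tendsto_zero [Fact (1 < L)] {i j : Fin d} (hij : i < j) :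
    Tendsto (fun β : ℝ => ∫ U, ∫ U', min
        (Real.exp (-β * wilsonAction (fundamentalRep (Fin 2)) U)
          / ∫ V, Real.exp (-β * wilsonAction (fundamentalRep (Fin 2)) V)
            ∂(Measure.pi fun _ : Edge d L => haarProbability (Matrix.specialUnitaryGroup (Fin 2) ℂ)))
        (Real.exp (-β * wilsonAction (fundamentalRep (Fin 2)) U')
          / ∫ V, Real.exp (-β * wilsonAction (fundamentalRep (Fin 2)) V)
            ∂(Measure.pi fun _ : Edge d L => haarProbability (Matrix.specialUnitaryGroup (Fin 2) ℂ)))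
        ∂(Measure.pi fun _ : Edge d L => haarProbability (Matrix.specialUnitaryGroup (Fin 2) ℂ))
        ∂(Measure.pi fun _ : Edge d L => haarProbability (Matrix.specialUnitaryGroup (Fin 2) ℂ)))
      atTop (𝓝 0) :=
  wilsonIdentityFlow_meanAccept_weakCoupling_tendsto_zero (d := d) (L := L) (fundamentalRep (Fin 2))
    (continuous_fundamentalRep (Fin 2)) (measure_pi_su2_wilsonAction_eq_zero_null hij)

end Wilson

end Summit.Ventures.LatticeQCDFlow.Theory2

end
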